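import Literature.AnabelianGeometry.SemiGraphs.Arithmetic
import Literature.AnabelianGeometry.SemiGraphs.ArithMaximalCompact

/-!
# Arithmetic tempered coverings ([SemiAnbd] §5: Def 5.1 (iv) general case, Prop 5.2, Rmk 5.2.1, Thm 5.4 (iii), Lem 5.5)

Mochizuki, *Semi-graphs of anabelioids*, Publ. RIMS **42** (2006), §5 pp.63–68 of the author's
manuscript (kurims `paper:url-f33ace170ff4`). [cite: MochizukiSemiAnbd2006, Prop 5.2, p. 63]

Over `Arithmetic.lean` (Def 5.1) and `ArithMaximalCompact.lean` (Def 5.3, arithmetically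
quasi-geometric homomorphisms):

* Def 5.1 (iv), general case: `ArithFamilyHom` (one component morphism from each connected
  component) with the printed fibre conditions for the nine classes of morphisms.
* Def 5.1 (iii), the local adjectives ("elevated at a vertex", "sub-coverticial at a closed edge",
  …) transferred from the geometric component, over a small stub-container `LocalAdjectives 𝓥` of
  t1's per-vertex / per-edge predicates of Def 2.4 (TODO-merge abc-iut-L3-t1); the "totally …"
  adjectives are in `Arithmetic.lean`.
* `ArithHom.comp` / `ArithHom.id` (composition of representatives) — bookkeeping.
* Prop 5.2 (i), (ii) as `Prop`-valued STATEMENTS on the interface (`…Statement 𝓥`), not asserted.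
  AUTHOR'S CORRECTION ([IUTchI] Rmk 2.5.3 (vi), kurims ms pp.55–56; cell RULING ρ, this revision
  supersedes p404854): "in order to carry out the argument stated in the proof of [SemiAnbd],
  Proposition 5.2, (i), it is necessary to strengthen the conditions (c) and (d) of [SemiAnbd],
  Definition 5.1, (i)" to the component-wise (c^new), (d^new); "this strengthening … has no effect
  either on the remainder of [SemiAnbd] or on subsequent papers of the author" — i.e. the author
  REPLACES (d) by (d^new) for all downstream use ((c^new) is automatic by (O3) [NS]).  Since the
  frozen `ArithSemiGraph` (`Arithmetic.lean`) packages the original (a)–(d), every arithmetic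
  semi-graph of anabelioids entering or leaving Prop 5.2 (i)/(ii) is required here to satisfy the
  corrected definition through the explicit guard `ArithSemiGraph.SatisfiesDNew` (= some open
  `H ⊆ π̂₁(A)` witnesses (a)–(d) AND (d^new), `Def51CondDNew` of `Arithmetic.lean`).
* Prop 5.2 (iii), (iv): the natural morphisms `B^temp(𝔾) → B^temp(𝔊) → A^⊤`, `B(𝔾) → B(𝔊) → A` and
  the exact sequences `1 → Π^temp_𝔾 → Π^temp_𝔊 → Π_A → 1`, `1 → Π_𝔾 → Π_𝔊 → Π_A → 1` are typed as a
  `Prop`-valued structure `FundamentalExactSequences` ON CANDIDATE GROUPS (the geometric /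
  geometric tempered / arithmetic / arithmetic tempered / BC- fundamental groups of `𝔊` enter as
  parameters; their construction — `π₁^temp` of the connected temperoid `B^temp(𝔊)`, t2's Prop 3.2
  / Rmk 3.2.1, and t1's `π̂₁(B(·))` — is TODO-merge abc-iut-L3-t2 / t1), together with the slimness
  clause of (iii) (`temp-slim` = `IsSlimGroup` for the tempered group, Def 3.4 (ii) p.36).  The
  clauses "`B^temp(𝔊)` is a connected temperoid" / "`B(𝔊)` is a connected anabelioid" need t2's
  temperoid vocabulary (Def 3.1 (ii)) and are recorded, not typed.
* Rmk 5.2.1: expository ("one could proceed to develop a theory of categories of arithmetic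
  localizations … we leave the details to the enthusiastic reader"), not typed.
* Thm 5.4 (iii): "applying `B^temp(−)` determines a natural bijective correspondence between
  locally open morphisms `𝔊 → ℍ` over `A` and arithmetically quasi-geometric morphisms of temperoids
  `B^temp(𝔊) → B^temp(ℍ)` over `A^⊤`" — typed as a statement over explicit inputs: the arithmetic
  tempered fundamental groups with their augmentations and the map "apply `B^temp`" on locally open
  morphisms (TODO-merge abc-iut-L3-t2, Prop 3.6 (iv) functoriality); morphisms of temperoids are
  continuous homomorphisms up to inner automorphism of the target (Prop 3.2).  A PREDICATE ON THE
  DATA, asserted in print only under the frame hypotheses of Thm 5.4 (p.66 ll.2–8, quoted in the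
  docstring, as in `ArithMaximalCompact.lean`).
* Lem 5.5 (decomposition groups of proper hyperbolic curves over finite fields; "well-known",
  [Naka], [NTs], [Mzk2]) as a statement on abstract data `Π_X ↠ G_k` with the sections of the
  `k`-points (TODO-merge abc-iut-L4-t1: étale `π₁` with augmentation, FOUNDATIONS row 12).
* Ex 5.6 (pointed stable curves over `p`-adic local fields II) and Rmk 5.6.1 (its profinite
  version) are NOT typed here: they are typed in `ArithmeticCurves.lean` as a tower structure
  parametrised by abc-iut-L3-t2's `TemperedArithmeticGroup` (Example 3.10; cell RULING ε).
Nothing in this file asserts a result of the paper.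
-/

namespace Literature.AnabelianGeometry.SemiGraphs

open _root_.CategoryTheory Literature.AlgebraicGeometry.Frobenioids

universe u v w

variable {Obj : Type u} [Category.{v} Obj] (𝓥 : SemiAnbdVocab.{u, v, w} Obj)

/-! ### Definition 5.1 (iv), general case -/

/-- **Def 5.1 (iv)** (general case): a morphism of arithmetic semi-graphs of anabelioids "is a
collection of morphisms, one from each connected component of `𝔊'` to some connected component of
`𝔊`". [cite: MochizukiSemiAnbd2006, Def 5.1 (iv), p. 63] -/
structure ArithFamilyHom (𝔉' 𝔉 : ArithSemiGraphFamily 𝓥) where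
  /-- the induced map on connected components -/
  toComp : 𝔉'.ι → 𝔉.ι
  /-- the component morphisms -/
  hom : ∀ i : 𝔉'.ι, ArithHom 𝓥 (𝔉'.comp i) (𝔉.comp (toComp i))

namespace ArithFamilyHom

variable {𝓥} {𝔉' 𝔉 : ArithSemiGraphFamily 𝓥}

/-- **Def 5.1 (iv)** *finite étale*: every component morphism finite étale and the induced map on
connected components "has finite [but possibly empty] fibers". [cite: MochizukiSemiAnbd2006, Def 5.1 (iv), p. 63] -/
def IsFiniteEtale (Φ : ArithFamilyHom 𝓥 𝔉' 𝔉) : Prop :=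
  (∀ i, (Φ.hom i).IsFiniteEtale) ∧ ∀ j, Finite (Φ.toComp ⁻¹' {j})

/-- **Def 5.1 (iv)** *tempered*: components tempered, "countable fibers".
[cite: MochizukiSemiAnbd2006, Def 5.1 (iv), p. 63] -/
def IsTempered (Φ : ArithFamilyHom 𝓥 𝔉' 𝔉) : Prop :=
  (∀ i, (Φ.hom i).IsTempered) ∧ ∀ j, Countable (Φ.toComp ⁻¹' {j})

/-- **Def 5.1 (iv)** *locally trivial*: components locally trivial (fibers arbitrary).
[cite: MochizukiSemiAnbd2006, Def 5.1 (iv), p. 63] -/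
def IsLocallyTrivial (Φ : ArithFamilyHom 𝓥 𝔉' 𝔉) : Prop := ∀ i, (Φ.hom i).IsLocallyTrivial

/-- **Def 5.1 (iv)** *locally open*: components locally open (fibers arbitrary).
[cite: MochizukiSemiAnbd2006, Def 5.1 (iv), p. 63] -/
def IsLocallyOpen (Φ : ArithFamilyHom 𝓥 𝔉' 𝔉) : Prop := ∀ i, (Φ.hom i).IsLocallyOpen

/-- **Def 5.1 (iv)** *locally finite étale*: components locally finite étale (fibers arbitrary).
[cite: MochizukiSemiAnbd2006, Def 5.1 (iv), p. 63] -/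
def IsLocallyFiniteEtale (Φ : ArithFamilyHom 𝓥 𝔉' 𝔉) : Prop := ∀ i, (Φ.hom i).IsLocallyFiniteEtale

/-- **Def 5.1 (iv)** *immersive*: components immersive (fibers arbitrary).
[cite: MochizukiSemiAnbd2006, Def 5.1 (iv), p. 63] -/
def IsImmersive (Φ : ArithFamilyHom 𝓥 𝔉' 𝔉) : Prop := ∀ i, (Φ.hom i).IsImmersive

/-- **Def 5.1 (iv)** *excisive*: components excisive (fibers arbitrary).
[cite: MochizukiSemiAnbd2006, Def 5.1 (iv), p. 63] -/
def IsExcisive (Φ : ArithFamilyHom 𝓥 𝔉' 𝔉) : Prop := ∀ i, (Φ.hom i).IsExcisive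

/-- **Def 5.1 (iv)** *embedding*: components embeddings and the induced map on connected
components "is injective". [cite: MochizukiSemiAnbd2006, Def 5.1 (iv), p. 63] -/
def IsEmbedding (Φ : ArithFamilyHom 𝓥 𝔉' 𝔉) : Prop :=
  (∀ i, (Φ.hom i).IsEmbedding) ∧ Function.Injective Φ.toComp

/-- **Def 5.1 (iv)** *BC-finite étale*: components BC-finite étale, "finite [but possibly empty]
fibers". [cite: MochizukiSemiAnbd2006, Def 5.1 (iv), p. 63] -/
def IsBCFiniteEtale (Φ : ArithFamilyHom 𝓥 𝔉' 𝔉) : Prop :=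
  (∀ i, (Φ.hom i).IsBCFiniteEtale) ∧ ∀ j, Finite (Φ.toComp ⁻¹' {j})

end ArithFamilyHom

/-! ### Definition 5.1 (iii): the local adjectives (over a container of t1's local predicates) -/

/-- STUB-CONTAINER (TODO-merge abc-iut-L3-t1, Def 2.4 (i), (iii), (iv) pp.25–26): the per-vertex /
per-edge predicates of §2 that Def 5.1 (iii) transfers to arithmetic semi-graphs of anabelioids
("elevated at a vertex; sub-coverticial at a closed edge; universally sub-coverticial at a closed
edge; aloof at an edge; estranged at an edge").  [cite: MochizukiSemiAnbd2006, Def 2.4, p. 25] -/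
structure LocalAdjectives where
  /-- `v` is elevated (Def 2.4 (i)) -/
  IsElevatedAt : (G : Obj) → 𝓥.Vert G → Prop
  /-- the closed edge `e` is sub-coverticial (Def 2.4 (iii)) -/
  IsSubcoverticialAt : (G : Obj) → 𝓥.Edge G → Prop
  /-- the closed edge `e` is universally sub-coverticial (Def 2.4 (iii)) -/
  IsUnivSubcoverticialAt : (G : Obj) → 𝓥.Edge G → Prop
  /-- the edge `e` is aloof (Def 2.4 (iv)) -/
  IsAloofAt : (G : Obj) → 𝓥.Edge G → Prop
  /-- the edge `e` is estranged (Def 2.4 (iv)) -/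
  IsEstrangedAt : (G : Obj) → 𝓥.Edge G → Prop

namespace ArithSemiGraphFamily

variable {𝓥} (𝓛 : LocalAdjectives 𝓥) (𝔉 : ArithSemiGraphFamily 𝓥)

/-- **Def 5.1 (iii)**: `𝔊` is *elevated at the vertex* `v` (of the component `i`) if its geometric
component is. [cite: MochizukiSemiAnbd2006, Def 5.1 (iii), p. 63] -/
def IsElevatedAt (i : 𝔉.ι) (v : 𝓥.Vert (𝔉.comp i).G) : Prop := 𝓛.IsElevatedAt _ v

/-- **Def 5.1 (iii)**: *sub-coverticial at the closed edge* `e`. [cite: MochizukiSemiAnbd2006, Def 5.1 (iii), p. 63] -/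
def IsSubcoverticialAt (i : 𝔉.ι) (e : 𝓥.Edge (𝔉.comp i).G) : Prop := 𝓛.IsSubcoverticialAt _ e

/-- **Def 5.1 (iii)**: *universally sub-coverticial at the closed edge* `e`.
[cite: MochizukiSemiAnbd2006, Def 5.1 (iii), p. 63] -/
def IsUnivSubcoverticialAt (i : 𝔉.ι) (e : 𝓥.Edge (𝔉.comp i).G) : Prop := 𝓛.IsUnivSubcoverticialAt _ e

/-- **Def 5.1 (iii)**: *totally sub-coverticial*: every closed edge of the geometric component is
sub-coverticial. [cite: MochizukiSemiAnbd2006, Def 5.1 (iii), p. 63] -/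
def IsTotallySubcoverticial (𝓛 : LocalAdjectives 𝓥) (𝔉 : ArithSemiGraphFamily 𝓥) : Prop :=
  ∀ (i : 𝔉.ι) (e : 𝓥.Edge (𝔉.comp i).G), 𝓥.IsClosedEdge e → 𝓛.IsSubcoverticialAt _ e

/-- **Def 5.1 (iii)**: *aloof at the edge* `e`; "totally aloof" holds for every object of the ambient
category (all objects are totally aloof, verticially slim). [cite: MochizukiSemiAnbd2006, Def 5.1 (iii), p. 63] -/
def IsAloofAt (i : 𝔉.ι) (e : 𝓥.Edge (𝔉.comp i).G) : Prop := 𝓛.IsAloofAt _ e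

/-- **Def 5.1 (iii)**: *estranged at the edge* `e`. [cite: MochizukiSemiAnbd2006, Def 5.1 (iii), p. 63] -/
def IsEstrangedAt (i : 𝔉.ι) (e : 𝓥.Edge (𝔉.comp i).G) : Prop := 𝓛.IsEstrangedAt _ e

end ArithSemiGraphFamily

/-! ### Composition of representatives -/

namespace ArithHom

variable {𝓥} {𝔊₁ 𝔊₂ 𝔊₃ : ArithSemiGraph 𝓥}

/-- Composition of (representatives of) morphisms of connected arithmetic semi-graphs of
anabelioids: compose both components. [cite: MochizukiSemiAnbd2006, Def 5.1 (iv), p. 63] -/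
def comp (φ : ArithHom 𝓥 𝔊₁ 𝔊₂) (ψ : ArithHom 𝓥 𝔊₂ 𝔊₃) : ArithHom 𝓥 𝔊₁ 𝔊₃ where
  arith := ψ.arith.comp φ.arith
  continuous_arith := ψ.continuous_arith.comp φ.continuous_arith
  geom := φ.geom ≫ ψ.geom
  compat a := by
    rw [MonoidHom.comp_apply, ← Category.assoc, φ.compat, Category.assoc, ψ.compat, Category.assoc]

/-- The identity morphism. [cite: MochizukiSemiAnbd2006, Def 5.1 (iv), p. 63] -/
def id (𝔊 : ArithSemiGraph 𝓥) : ArithHom 𝓥 𝔊 𝔊 where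
  arith := MonoidHom.id _
  continuous_arith := continuous_id
  geom := 𝟙 𝔊.G
  compat a := by simp

/-- `φ : ℌ → 𝔊` and `ψ : 𝔎 → 𝔊` have isomorphic geometric components as coverings of `𝔾`.
[cite: MochizukiSemiAnbd2006, Prop 5.2 (ii), p. 63] -/
def GeomIsoOver {ℌ 𝔎 𝔊 : ArithSemiGraph 𝓥} (φ : ArithHom 𝓥 ℌ 𝔊) (ψ : ArithHom 𝓥 𝔎 𝔊) : Prop :=
  ∃ i : ℌ.G ≅ 𝔎.G, i.hom ≫ ψ.geom = φ.geom

end ArithHom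

/-! ### [IUTchI] Rmk 2.5.3 (vi): the corrected Definition 5.1 (i), as a guard -/

namespace ArithSemiGraph

variable {𝓥}

/-- ERRATUM GUARD ([IUTchI] Rmk 2.5.3 (vi), kurims ms pp.55–56; cell RULING ρ): `𝔊` is an arithmetic
semi-graph of anabelioids in the author's CORRECTED sense — for some open subgroup `H ⊆ π̂₁(A)`
witnessing the continuity conditions (a)–(d) of Def 5.1 (i), the component-wise strengthening
(d^new) ("there is a finite set `C*` of components of `𝔾` such that for every component `c` … an
isomorphism `𝔾[c] ⥲ 𝔾[c*]` compatible with the action of `H`", `Def51CondDNew`) also holds; the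
author: "it is necessary to strengthen the conditions (c) and (d) … this strengthening … has no
effect … on the remainder of [SemiAnbd] or on subsequent papers" — so every downstream use of
Def 5.1 is of the strengthened notion ((c^new) is automatic by (O3) [NS]).  Source: [IUTchI]
Rmk 2.5.3 (vi) p.56. [claim: Mochizuki2012, status: disputed] -/
def SatisfiesDNew (𝔊 : ArithSemiGraph 𝓥) : Prop :=
  ∃ (H : OpenSubgroup 𝔊.PA) (hH : IsContinuousActionAt 𝓥 𝔊.G 𝔊.PA 𝔊.ρ H),
    Def51CondDNew 𝓥 𝔊.G 𝔊.PA 𝔊.ρ H hH.condC.fixesVert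
      (fixesEdge_of_fixesBr 𝓥 𝔊.G 𝔊.PA 𝔊.ρ H hH.condC.fixesBr)

/-- A (d^new)-arithmetic semi-graph of anabelioids has, in particular, a continuous arithmetic
action in the sense of Def 5.1 (i) (a)–(d) (bookkeeping). [cite: MochizukiSemiAnbd2006, Def 5.1 (i), p. 62] -/
theorem SatisfiesDNew.isContinuousAction {𝔊 : ArithSemiGraph 𝓥} (h : 𝔊.SatisfiesDNew) :
    IsContinuousAction 𝓥 𝔊.G 𝔊.PA 𝔊.ρ := by
  obtain ⟨H, hH, -⟩ := h
  exact ⟨H, hH⟩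

end ArithSemiGraph

/-! ### Proposition 5.2 (Arithmetic Tempered Coverings) — (i), (ii) as statements -/

/-- **Prop 5.2 (i)**: "every tempered covering of `𝔾` appears as the geometric component of a
tempered covering of `𝔊`" — rendered for a connected tempered covering `f : H → 𝔾`: some tempered
morphism `ℌ → 𝔊` has geometric component isomorphic to `f` over `𝔾`.  GUARD (RULING ρ, [IUTchI]
Rmk 2.5.3 (vi) p.56: "in order to carry out the argument stated in the proof of [SemiAnbd],
Proposition 5.2, (i), it is necessary to strengthen the conditions (c) and (d)"): `𝔊` — and the
produced `ℌ`, an arithmetic semi-graph of anabelioids in the corrected sense — satisfy (d^new)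
(`ArithSemiGraph.SatisfiesDNew`); the corrected print vouches for nothing about (d)-only objects.
[cite: MochizukiSemiAnbd2006, Prop 5.2 (i), p. 63] -/
def TemperedCoveringsLiftStatement (𝓥 : SemiAnbdVocab.{u, v, w} Obj) : Prop :=
  ∀ (𝔊 : ArithSemiGraph 𝓥), 𝔊.SatisfiesDNew → ∀ (H : Obj) (f : H ⟶ 𝔊.G),
    𝓥.IsConnected H → 𝓥.IsTempered f →
      ∃ (ℌ : ArithSemiGraph 𝓥) (φ : ArithHom 𝓥 ℌ 𝔊) (i : ℌ.G ≅ H),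
        ℌ.SatisfiesDNew ∧ φ.IsTempered ∧ i.hom ≫ f = φ.geom

/-- **Prop 5.2 (ii)**: if `ℌ → 𝔊`, `𝔎 → 𝔊` are tempered coverings with isomorphic geometric
components, "there exist BC-finite étale coverings `ℌ' → ℌ`, `𝔎' → 𝔎` such that `ℌ'`, `𝔎'` are
isomorphic as tempered coverings over `𝔊`" (isomorphic over `𝔊` up to the inner action, Def 5.1 (iv)).
GUARD (RULING ρ, [IUTchI] Rmk 2.5.3 (vi): the author replaces (d) by (d^new) for all downstream use):
`𝔊`, `ℌ`, `𝔎` — and the produced `ℌ'`, `𝔎'` — are arithmetic semi-graphs of anabelioids in the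
corrected sense (`ArithSemiGraph.SatisfiesDNew`). [cite: MochizukiSemiAnbd2006, Prop 5.2 (ii), p. 63] -/
def TemperedCoveringsBCStatement (𝓥 : SemiAnbdVocab.{u, v, w} Obj) : Prop :=
  ∀ (𝔊 ℌ 𝔎 : ArithSemiGraph 𝓥), 𝔊.SatisfiesDNew → ℌ.SatisfiesDNew → 𝔎.SatisfiesDNew →
    ∀ (φ : ArithHom 𝓥 ℌ 𝔊) (ψ : ArithHom 𝓥 𝔎 𝔊),
      φ.IsTempered → ψ.IsTempered → φ.GeomIsoOver ψ →
        ∃ (ℌ' 𝔎' : ArithSemiGraph 𝓥) (a : ArithHom 𝓥 ℌ' ℌ) (b : ArithHom 𝓥 𝔎' 𝔎)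
          (c : ArithHom 𝓥 ℌ' 𝔎'),
          ℌ'.SatisfiesDNew ∧ 𝔎'.SatisfiesDNew ∧
            a.IsBCFiniteEtale ∧ b.IsBCFiniteEtale ∧ c.IsIsomorphism ∧
              ArithHom.InnerEquiv (c.comp (b.comp ψ)) (a.comp φ)

/-! ### Proposition 5.2 (iii), (iv) — on candidate fundamental groups -/

section FundamentalGroups

variable {𝓥}
variable (𝔊 : ArithSemiGraph 𝓥)
variable (GtpGeom : Type*) [Group GtpGeom] [TopologicalSpace GtpGeom]
variable (Gtp : Type*) [Group Gtp] [TopologicalSpace Gtp]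
variable (GhatGeom Ghat : ProfiniteGrp.{w})

/-- **Prop 5.2 (iv)** (shape of the statement, on candidate groups): writing
`Π^temp_𝔾 := π₁^temp(B^temp(𝔾))` (geometric tempered), `Π^temp_𝔊 := π₁^temp(B^temp(𝔊))` (arithmetic
tempered), `Π_𝔾 := π̂₁(B(𝔾))` (geometric), `Π_𝔊 := π̂₁(B(𝔊))` (arithmetic), `Π_A := π̂₁(A)` (BC-fundamental
group), "there are natural morphisms `B^temp(𝔾) → B^temp(𝔊) → A^⊤`; `B(𝔾) → B(𝔊) → A` which induce
natural exact sequences `1 → Π^temp_𝔾 → Π^temp_𝔊 → Π_A → 1`, `1 → Π_𝔾 → Π_𝔊 → Π_A → 1`".  Here the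
four groups are PARAMETERS (their construction is TODO-merge abc-iut-L3-t2 / t1) and the structure
records continuity and exactness of the two sequences. [cite: MochizukiSemiAnbd2006, Prop 5.2 (iv), p. 64] -/
structure FundamentalExactSequences (ιtp : GtpGeom →* Gtp) (augtp : Gtp →* 𝔊.PA)
    (ι : GhatGeom →* Ghat) (aug : Ghat →* 𝔊.PA) : Prop where
  /-- `Π^temp_𝔾 → Π^temp_𝔊` is continuous -/
  continuous_ιtp : Continuous ιtp
  /-- `Π^temp_𝔊 → Π_A` is continuous -/
  continuous_augtp : Continuous augtp
  /-- exactness of `1 → Π^temp_𝔾 → Π^temp_𝔊 → Π_A → 1` -/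
  exact_tp : Function.Injective ιtp ∧ ιtp.range = augtp.ker ∧ Function.Surjective augtp
  /-- `Π_𝔾 → Π_𝔊` is continuous -/
  continuous_ι : Continuous ι
  /-- `Π_𝔊 → Π_A` is continuous -/
  continuous_aug : Continuous aug
  /-- exactness of `1 → Π_𝔾 → Π_𝔊 → Π_A → 1` -/
  exact_hat : Function.Injective ι ∧ ι.range = aug.ker ∧ Function.Surjective aug

/-- **Prop 5.2 (iii)**, slimness clause (on candidate groups): "if `𝔊` is totally elevated, then
`B^temp(𝔊)` [is] temp-slim, and `B(𝔊)` is slim" — temp-slimness of the tempered group `Π^temp_𝔊`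
(Def 3.4 (ii): trivial centralisers of open subgroups, i.e. `IsSlimGroup`) and slimness of `Π_𝔊`
(§0 p.6).  [The clauses "`B^temp(𝔊)` is a connected temperoid", "`B(𝔊)` a connected anabelioid"
need the temperoid vocabulary of §3 and are not typed here.] [cite: MochizukiSemiAnbd2006, Prop 5.2 (iii), p. 64] -/
def TotallyElevatedSlimStatement (𝔊 : ArithSemiGraph 𝓥) (Gtp : Type*) [Group Gtp] [TopologicalSpace Gtp]
    (Ghat : ProfiniteGrp.{w}) : Prop :=
  𝓥.IsTotallyElevated 𝔊.G → IsSlimGroup Gtp ∧ IsSlimGroup Ghat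

end FundamentalGroups

/-! ### Theorem 5.4 (iii) — statement over explicit inputs -/

section Thm54iii

variable {𝓥}
variable (𝔊 ℍ : ArithSemiGraph 𝓥) (e : 𝔊.PA ≃* ℍ.PA)
variable {Gtp : Type*} [Group Gtp] [TopologicalSpace Gtp]
variable {Htp : Type*} [Group Htp] [TopologicalSpace Htp]

/-- A morphism `𝔊 → ℍ` *over `A`* ("with the same arithmetic component `A`", p.66): its arithmetic
component is the given identification `e : π̂₁(A) = π̂₁(A)`. [cite: MochizukiSemiAnbd2006, Thm 5.4, p. 66] -/
def ArithHom.IsOverA (φ : ArithHom 𝓥 𝔊 ℍ) : Prop := ∀ a, φ.arith a = e a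

/-- **Thm 5.4 (iii)** (conclusion, as a predicate on explicit data; asserted in print under the
frame hypotheses of Thm 5.4, p.66: "Let `𝔊`, `ℍ` be connected, countable, totally elevated, totally
arithmetically estranged arithmetic graphs of anabelioids, with the same arithmetic component `A`.
Suppose, moreover, that the arithmetic actions on the underlying graphs `𝔾`, `ℍ` of `𝔊`, `ℍ` do
not switch the branches of any edge" — arithmetic semi-graphs of anabelioids in the sense of
Def 5.1 as corrected by [IUTchI] Rmk 2.5.3 (vi), cf. `ArithSemiGraph.SatisfiesDNew`): given the
arithmetic tempered fundamental groups `Π^temp_𝔊`, `Π^temp_ℍ` with their augmentations to `Π_A` and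
the map "apply `B^temp(−)`" sending a locally open morphism `𝔊 → ℍ` over `A` to a continuous
homomorphism `Π^temp_𝔊 → Π^temp_ℍ` (a representative of the morphism of temperoids, Prop 3.6 (iv);
TODO-merge abc-iut-L3-t2), that map "determines a natural bijective correspondence between locally
open morphisms `𝔊 → ℍ` over `A` [up to the inner action, Def 5.1 (iv)] and arithmetically
quasi-geometric morphisms of temperoids `B^temp(𝔊) → B^temp(ℍ)` over `A^⊤` [continuous
homomorphisms up to inner automorphism of the target]".  Not asserted for arbitrary data.
[cite: MochizukiSemiAnbd2006, Thm 5.4 (iii), p. 66] -/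
def ArithQuasiGeometricCorrespondenceStatement (augG : Gtp →* 𝔊.PA) (augH : Htp →* ℍ.PA)
    (btemp : (φ : ArithHom 𝓥 𝔊 ℍ) → φ.IsLocallyOpen → ArithHom.IsOverA 𝔊 ℍ e φ → (Gtp →* Htp)) :
    Prop :=
  let augH' : Htp →* 𝔊.PA := e.symm.toMonoidHom.comp augH
  (∀ (φ : ArithHom 𝓥 𝔊 ℍ) (h₁ : φ.IsLocallyOpen) (h₂ : ArithHom.IsOverA 𝔊 ℍ e φ),
      IsArithQuasiGeometric augG augH' (btemp φ h₁ h₂)) ∧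
    (∀ (φ ψ : ArithHom 𝓥 𝔊 ℍ) (h₁ : φ.IsLocallyOpen) (h₂ : ArithHom.IsOverA 𝔊 ℍ e φ)
        (k₁ : ψ.IsLocallyOpen) (k₂ : ArithHom.IsOverA 𝔊 ℍ e ψ),
      ArithHom.InnerEquiv φ ψ ↔
        ∃ h : Htp, ∀ g, btemp ψ k₁ k₂ g = h * btemp φ h₁ h₂ g * h⁻¹) ∧
    ∀ f : Gtp →* Htp, IsArithQuasiGeometric augG augH' f →
      ∃ (φ : ArithHom 𝓥 𝔊 ℍ) (h₁ : φ.IsLocallyOpen) (h₂ : ArithHom.IsOverA 𝔊 ℍ e φ) (h : Htp),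
        ∀ g, f g = h * btemp φ h₁ h₂ g * h⁻¹

end Thm54iii

/-! ### Lemma 5.5 (statement on abstract data) -/

/-- **Lem 5.5** (Decomposition Groups of Proper Hyperbolic Curves over Finite Fields; "well-known"
— [Naka] Claim (2.2), [NTs] Lemma (4.14), [Mzk2]): for `X` a proper hyperbolic curve over a finite
field `k`, with `Π_X` its étale fundamental group and `Π_X ↠ G_k` the natural augmentation, "a
`k`-valued point `x ∈ X(k)` is determined by the outer homomorphism `σ_x : G_k → Π_X` that it
induces".  Typed on abstract data: the augmented group, the set of `k`-points and their sections
(TODO-merge abc-iut-L4-t1: étale `π₁` of curves with augmentation) — the map `x ↦ [σ_x]` to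
`Π_X`-conjugacy classes of sections is injective. [cite: MochizukiSemiAnbd2006, Lem 5.5, p. 66] -/
def DecompositionGroupsDetermineStatement {PX Gk : Type*} [Group PX] [Group Gk] (aug : PX →* Gk)
    {Pts : Type*} (σ : Pts → (Gk →* PX)) : Prop :=
  (∀ x, aug.comp (σ x) = MonoidHom.id Gk) →
    ∀ x y : Pts, (∃ g : PX, ∀ t : Gk, σ y t = g * σ x t * g⁻¹) → x = y

end Literature.AnabelianGeometry.SemiGraphs
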